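import Mathlib.Analysis.Analytic.IsolatedZeros
import Mathlib.Analysis.Analytic.ChangeOrigin
import Mathlib.Analysis.Calculus.FormalMultilinearSeries
import Mathlib.Analysis.Complex.RealDeriv
import Mathlib.Algebra.Ring.Periodic
import Mathlib.Algebra.Order.ToIntervalMod
import Mathlib.Analysis.Convex.Topology
import Mathlib.Topology.MetricSpace.Pseudo.Lemmas
import HarnessLib

/-!
# Holomorphic extension of real-analytic functions of one real variable

Classical complex analysis (topic `Analysis/Complex`), proofs plus one explicit definition.  A
real-analytic function `f : ℝ → E` with values in a complex Banach space extends to a holomorphic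
function on a complex neighbourhood of the real axis (e.g. Krantz–Parks, *A Primer of Real Analytic
Functions* (2002), §1.2 / Prop. 1.2.3 pattern in one variable; Cartan, *Elementary theory of
analytic functions*, Ch. IV §2): one re-sums the real Taylor series with a complex increment and
patches the local sums by the identity theorem.

* `complexifySeries p` — the complex power series `∑ (z - x)ⁿ • aₙ` with the same vector
  coefficients `aₙ = p.coeff n ∈ E` as the real one-variable series `p`; same norms, same radius
  (`norm_complexifySeries`, `radius_complexifySeries`), same values at real increments
  (`complexifySeries_apply_ofReal`);
* `hasFPowerSeriesOnBall_complexify` — if `f` has the real expansion `p` on `(x - r, x + r)` then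
  `z ↦ (complexifySeries p).sum (z - x)` is holomorphic on the complex ball `B(x, r)` with that
  expansion, and equals `f` at the real points of the ball (`complexify_sum_eq`);
* `exists_holomorphic_extension` — **uniform-radius patching**: if `f` has a real expansion of
  radius `ρ` at every point of a set `S ⊆ ℝ`, there is ONE function `F`, holomorphic on
  `⋃_{x ∈ S} B(x, ρ/2) ⊂ ℂ`, equal to `f` at all real points of that set (two local sums agree on
  the overlap of their balls by the identity theorem, since they agree with `f` on a real interval);
* `exists_uniform_radius_of_isCompact` — on a compact interval a real-analytic function has
  expansions of a uniform radius (Lebesgue number + `HasFPowerSeriesOnBall.changeOrigin`);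
* `periodic_exists_holomorphic_extension_strip` — **the periodic case**: a real-analytic
  `T`-periodic `f` extends to a holomorphic `T`-periodic `F` on a strip `{|Im z| < δ}`, with
  `F = f` on `ℝ` and the complex derivative of `F` at real points equal to the real derivative of
  `f` (`deriv_extension_ofReal`); `periodic_exists_holomorphic_extension_strip'` gives `F`
  globally `T`-periodic (`periodize`), ready for Mathlib's `Function.Periodic.cuspFunction`.

Use (seat of `Literature.Geometry.Symplectic.palf_stein_supportedByBoundaryOpenBook`): the
complexified parametrisation `Ξ(σ, η) = K(σ) + η ν(σ)` of the collar of a real-analytic Legendrian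
curve is holomorphic on a strip (Forstnerič–Kozak 2003, §4), the input of the biholomorphic chart
`Literature/Analysis/Calculus/LocalInverseOnCompact.lean`.

Everything is proved; definitions `complexifySeries`, `periodize` (explicit), no named fact.

## References

* S. G. Krantz, H. R. Parks, *A Primer of Real Analytic Functions*, 2nd ed. (2002), §1.2.
  [KrantzParks2002]
* F. Forstnerič, J. Kozak, *Strongly pseudoconvex handlebodies*, J. Korean Math. Soc. 40 (2003),
  §4. [ForstnericKozak2003]
-/

open Set Function Filter Topology Metric
open scoped NNReal ENNReal

noncomputable section

namespace Literature.Analysis.Complex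

variable {E : Type*} [NormedAddCommGroup E] [NormedSpace ℂ E]

/-! ### Complexification of a one-variable real power series -/

/-- **The complexified series**: the complex one-variable power series with the same vector
coefficients `p.coeff n` as the real one-variable series `p`. [cite: KrantzParks2002, §1.2] -/
def complexifySeries (p : FormalMultilinearSeries ℝ ℝ E) : FormalMultilinearSeries ℂ ℂ E :=
  fun n => ContinuousMultilinearMap.mkPiRing ℂ (Fin n) (p.coeff n)

/-- Unfolding: `complexifySeries p n (y) = (∏ yᵢ) • p.coeff n`. [folklore] -/
theorem complexifySeries_apply (p : FormalMultilinearSeries ℝ ℝ E) (n : ℕ) (y : Fin n → ℂ) :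
    complexifySeries p n y = (∏ i, y i) • p.coeff n := by
  simp [complexifySeries, ContinuousMultilinearMap.mkPiRing_apply]

/-- Same coefficients. [folklore] -/
@[simp]
theorem complexifySeries_coeff (p : FormalMultilinearSeries ℝ ℝ E) (n : ℕ) :
    (complexifySeries p).coeff n = p.coeff n := by
  show complexifySeries p n 1 = p.coeff n
  rw [complexifySeries_apply]
  simp only [Pi.one_apply, Finset.prod_const_one, one_smul]

/-- Same norms. [folklore] -/
@[simp]
theorem norm_complexifySeries (p : FormalMultilinearSeries ℝ ℝ E) (n : ℕ) :
    ‖complexifySeries p n‖ = ‖p n‖ := by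
  rw [complexifySeries, ContinuousMultilinearMap.norm_mkPiRing,
    FormalMultilinearSeries.norm_apply_eq_norm_coef]

/-- **Same radius of convergence.** [cite: KrantzParks2002, §1.2] -/
@[simp]
theorem radius_complexifySeries (p : FormalMultilinearSeries ℝ ℝ E) :
    (complexifySeries p).radius = p.radius := by
  simp only [FormalMultilinearSeries.radius, norm_complexifySeries]

/-- **Same values at real increments**: `complexifySeries p n (h, …, h) = p n (h, …, h)` for
`h ∈ ℝ`. [folklore] -/
theorem complexifySeries_apply_ofReal (p : FormalMultilinearSeries ℝ ℝ E) (n : ℕ) (h : ℝ) :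
    (complexifySeries p n fun _ => (h : ℂ)) = p n fun _ => h := by
  rw [complexifySeries_apply, FormalMultilinearSeries.apply_eq_pow_smul_coeff]
  simp only [Finset.prod_const, Finset.card_univ, Fintype.card_fin]
  rw [← Complex.ofReal_pow, Complex.coe_smul]

/-! ### The local holomorphic extension -/

variable [CompleteSpace E]

/-- **Local holomorphic extension.**  If `f : ℝ → E` has the real power series `p` on the ball of
radius `r` about `x`, then `z ↦ (complexifySeries p).sum (z - x)` has the complex power series
`complexifySeries p` on the complex ball of radius `r` about `x` (in particular it is holomorphic
there). [cite: KrantzParks2002, §1.2] -/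
theorem hasFPowerSeriesOnBall_complexify {f : ℝ → E} {p : FormalMultilinearSeries ℝ ℝ E} {x : ℝ}
    {r : ℝ≥0∞} (hf : HasFPowerSeriesOnBall f p x r) :
    HasFPowerSeriesOnBall (fun z : ℂ => (complexifySeries p).sum (z - x)) (complexifySeries p)
      (x : ℂ) r := by
  have hrad : 0 < (complexifySeries p).radius := by
    rw [radius_complexifySeries]
    exact hf.r_pos.trans_le hf.r_le
  have h0 : HasFPowerSeriesOnBall (complexifySeries p).sum (complexifySeries p) 0 r :=
    ((complexifySeries p).hasFPowerSeriesOnBall hrad).mono hf.r_pos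
      (by rw [radius_complexifySeries]; exact hf.r_le)
  have h1 := h0.comp_sub (x : ℂ)
  simpa using h1

omit [CompleteSpace E] in
/-- The local extension agrees with `f` at the real points of the ball:
`(complexifySeries p).sum h = f (x + h)` for real `h` with `‖h‖ < r`. [cite: KrantzParks2002, §1.2] -/
theorem complexify_sum_eq {f : ℝ → E} {p : FormalMultilinearSeries ℝ ℝ E} {x : ℝ} {r : ℝ≥0∞}
    (hf : HasFPowerSeriesOnBall f p x r) {h : ℝ} (hh : (‖h‖₊ : ℝ≥0∞) < r) :
    (complexifySeries p).sum (h : ℂ) = f (x + h) := by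
  have hmem : h ∈ Metric.eball (0 : ℝ) r := by
    rw [Metric.mem_eball, edist_zero_right]
    exact hh
  rw [FormalMultilinearSeries.sum, ← (hf.hasSum hmem).tsum_eq]
  congr 1
  funext n
  exact complexifySeries_apply_ofReal p n h

omit [CompleteSpace E] in
/-- The local extension at a real point `t` of the ball: `(complexifySeries p).sum (t - x) = f t`.
[folklore] -/
theorem complexify_sum_sub_eq {f : ℝ → E} {p : FormalMultilinearSeries ℝ ℝ E} {x : ℝ} {r : ℝ≥0∞}
    (hf : HasFPowerSeriesOnBall f p x r) {t : ℝ} (ht : (‖t - x‖₊ : ℝ≥0∞) < r) :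
    (complexifySeries p).sum ((t : ℂ) - x) = f t := by
  have h := complexify_sum_eq hf ht
  rw [add_sub_cancel] at h
  rw [← h]
  push_cast
  ring_nf

/-! ### Patching the local extensions: the identity theorem -/

/-- Two local holomorphic extensions of the same `f`, centred at real points `x₀`, `x₁` with a
common radius `ρ`, agree on the intersection of their balls (identity theorem: they are holomorphic
on the convex intersection and agree with `f` on a real interval around the midpoint).
[cite: KrantzParks2002, §1.2] -/
theorem complexify_sum_eqOn_inter {f : ℝ → E} {p₀ p₁ : FormalMultilinearSeries ℝ ℝ E}
    {x₀ x₁ : ℝ} {ρ : ℝ≥0} (h₀ : HasFPowerSeriesOnBall f p₀ x₀ ρ)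
    (h₁ : HasFPowerSeriesOnBall f p₁ x₁ ρ) (hx : dist x₀ x₁ < ρ) :
    EqOn (fun z : ℂ => (complexifySeries p₀).sum (z - x₀))
      (fun z : ℂ => (complexifySeries p₁).sum (z - x₁))
      (ball (x₀ : ℂ) ρ ∩ ball (x₁ : ℂ) ρ) := by
  have hρ : (0 : ℝ) < ρ := lt_of_le_of_lt dist_nonneg hx
  set U : Set ℂ := ball (x₀ : ℂ) ρ ∩ ball (x₁ : ℂ) ρ with hU
  have H₀ := hasFPowerSeriesOnBall_complexify h₀
  have H₁ := hasFPowerSeriesOnBall_complexify h₁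
  -- analyticity on `U`
  have hA₀ : AnalyticOnNhd ℂ (fun z : ℂ => (complexifySeries p₀).sum (z - x₀)) U := fun z hz =>
    H₀.analyticAt_of_mem (by rw [Metric.eball_coe]; exact hz.1)
  have hA₁ : AnalyticOnNhd ℂ (fun z : ℂ => (complexifySeries p₁).sum (z - x₁)) U := fun z hz =>
    H₁.analyticAt_of_mem (by rw [Metric.eball_coe]; exact hz.2)
  have hUc : IsPreconnected U := ((convex_ball _ _).inter (convex_ball _ _)).isPreconnected
  -- the real midpoint lies in `U`
  set m : ℝ := (x₀ + x₁) / 2 with hm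
  have hm₀ : dist m x₀ < ρ / 2 := by
    rw [Real.dist_eq, hm]
    rw [Real.dist_eq] at hx
    have : (x₀ + x₁) / 2 - x₀ = (x₁ - x₀) / 2 := by ring
    rw [this, abs_div, abs_two, abs_sub_comm]
    linarith
  have hm₁ : dist m x₁ < ρ / 2 := by
    rw [Real.dist_eq, hm]
    rw [Real.dist_eq] at hx
    have : (x₀ + x₁) / 2 - x₁ = (x₀ - x₁) / 2 := by ring
    rw [this, abs_div, abs_two]
    linarith
  have hmU : (m : ℂ) ∈ U := by
    refine ⟨?_, ?_⟩
    · rw [mem_ball, Complex.dist_eq, ← Complex.ofReal_sub, Complex.norm_real, Real.norm_eq_abs,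
        ← Real.dist_eq]
      linarith
    · rw [mem_ball, Complex.dist_eq, ← Complex.ofReal_sub, Complex.norm_real, Real.norm_eq_abs,
        ← Real.dist_eq]
      linarith
  -- both extensions equal `f` at the real points `m + s`, `|s| < ρ / 2`
  have hreal : ∀ s : ℝ, |s| < ρ / 2 →
      (complexifySeries p₀).sum (((m + s : ℝ) : ℂ) - x₀) = f (m + s) ∧
      (complexifySeries p₁).sum (((m + s : ℝ) : ℂ) - x₁) = f (m + s) := by
    intro s hs
    have e₀ : (‖(m + s) - x₀‖₊ : ℝ≥0∞) < ρ := by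
      rw [ENNReal.coe_lt_coe, ← NNReal.coe_lt_coe, coe_nnnorm, Real.norm_eq_abs]
      calc |m + s - x₀| = |(m - x₀) + s| := by ring_nf
        _ ≤ |m - x₀| + |s| := abs_add_le _ _
        _ < ρ / 2 + ρ / 2 := by rw [← Real.dist_eq]; exact add_lt_add hm₀ hs
        _ = ρ := by ring
    have e₁ : (‖(m + s) - x₁‖₊ : ℝ≥0∞) < ρ := by
      rw [ENNReal.coe_lt_coe, ← NNReal.coe_lt_coe, coe_nnnorm, Real.norm_eq_abs]
      calc |m + s - x₁| = |(m - x₁) + s| := by ring_nf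
        _ ≤ |m - x₁| + |s| := abs_add_le _ _
        _ < ρ / 2 + ρ / 2 := by rw [← Real.dist_eq]; exact add_lt_add hm₁ hs
        _ = ρ := by ring
    exact ⟨complexify_sum_sub_eq h₀ e₀, complexify_sum_sub_eq h₁ e₁⟩
  -- hence they agree frequently near `m` (along the real sequence `m + (ρ/4)/(k+1)`)
  have hfreq : ∃ᶠ z in 𝓝[≠] (m : ℂ), (complexifySeries p₀).sum (z - x₀) =
      (complexifySeries p₁).sum (z - x₁) := by
    set c : ℝ := (ρ : ℝ) / 4 with hc
    have hcpos : 0 < c := by rw [hc]; positivity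
    set sq : ℕ → ℂ := fun k => ((m + c * (1 / ((k : ℝ) + 1)) : ℝ) : ℂ) with hsq
    have hpos : ∀ k : ℕ, (0 : ℝ) < c * (1 / ((k : ℝ) + 1)) := fun k => by positivity
    have hlt : ∀ k : ℕ, c * (1 / ((k : ℝ) + 1)) < ρ / 2 := fun k => by
      have h1 : c * (1 / ((k : ℝ) + 1)) ≤ c := by
        refine mul_le_of_le_one_right hcpos.le ?_
        rw [div_le_one (by positivity)]
        have : (0 : ℝ) ≤ k := k.cast_nonneg
        linarith
      have h2 : c < ρ / 2 := by rw [hc]; linarith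
      linarith
    have htend : Tendsto sq atTop (𝓝[≠] (m : ℂ)) := by
      refine tendsto_nhdsWithin_iff.2 ⟨?_, Eventually.of_forall fun k => ?_⟩
      · have h2 : Tendsto (fun k : ℕ => m + c * (1 / ((k : ℝ) + 1))) atTop (𝓝 m) := by
          simpa using (tendsto_one_div_add_atTop_nhds_zero_nat.const_mul c).const_add m
        exact (Complex.continuous_ofReal.tendsto m).comp h2
      · rw [mem_compl_iff, mem_singleton_iff, hsq]
        intro h
        have := Complex.ofReal_injective h
        linarith [hpos k]
    refine htend.frequently (Frequently.of_forall fun k => ?_)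
    obtain ⟨e₀, e₁⟩ := hreal (c * (1 / ((k : ℝ) + 1))) (by rw [abs_of_pos (hpos k)]; exact hlt k)
    simp only [hsq]
    rw [e₀, e₁]
  exact hA₀.eqOn_of_preconnected_of_frequently_eq hA₁ hUc hmU hfreq

/-! ### The global extension for a uniform radius -/

/-- **Holomorphic extension of a real-analytic function with expansions of a uniform radius.**  If
`f : ℝ → E` has at every point of `S ⊆ ℝ` a real power series of radius `ρ`, then there is one
function `F : ℂ → E`, holomorphic (complex-analytic) on `V = ⋃_{x ∈ S} B(x, ρ/2)`, which equals
`f` at every real point of `V`. [cite: KrantzParks2002, §1.2] -/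
theorem exists_holomorphic_extension {f : ℝ → E} {S : Set ℝ} {ρ : ℝ≥0}
    (hf : ∀ x ∈ S, ∃ p : FormalMultilinearSeries ℝ ℝ E, HasFPowerSeriesOnBall f p x ρ) :
    ∃ F : ℂ → E, AnalyticOnNhd ℂ F (⋃ x ∈ S, ball (x : ℂ) (ρ / 2)) ∧
      ∀ t : ℝ, (t : ℂ) ∈ (⋃ x ∈ S, ball (x : ℂ) (ρ / 2)) → F t = f t := by
  classical
  -- choose the expansions and the local extensions
  choose p hp using hf
  set G : ℝ → ℂ → E := fun x z => if hx : x ∈ S then (complexifySeries (p x hx)).sum (z - x) else 0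
    with hG
  have hGS : ∀ x (hx : x ∈ S), G x = fun z => (complexifySeries (p x hx)).sum (z - x) := by
    intro x hx
    funext z
    simp [hG, hx]
  -- consistency on overlaps of the half-balls
  have hcons : ∀ x₀ (hx₀ : x₀ ∈ S) x₁ (hx₁ : x₁ ∈ S) (z : ℂ), z ∈ ball (x₀ : ℂ) (ρ / 2) →
      z ∈ ball (x₁ : ℂ) (ρ / 2) → G x₀ z = G x₁ z := by
    intro x₀ hx₀ x₁ hx₁ z hz₀ hz₁
    have hx : dist x₀ x₁ < ρ := by
      have h := dist_triangle_right (x₀ : ℂ) (x₁ : ℂ) z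
      rw [mem_ball, dist_comm] at hz₀ hz₁
      rw [Complex.dist_eq, ← Complex.ofReal_sub, Complex.norm_real, Real.norm_eq_abs,
        ← Real.dist_eq] at h
      linarith
    rw [hGS x₀ hx₀, hGS x₁ hx₁]
    have hρ2 : (ρ : ℝ) / 2 ≤ ρ := by linarith [(show (0:ℝ) ≤ ρ from ρ.2)]
    exact complexify_sum_eqOn_inter (hp x₀ hx₀) (hp x₁ hx₁) hx
      ⟨ball_subset_ball hρ2 hz₀, ball_subset_ball hρ2 hz₁⟩
  -- the global function
  set F : ℂ → E := fun z =>
    if h : ∃ x ∈ S, z ∈ ball (x : ℂ) (ρ / 2) then G h.choose z else 0 with hF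
  have hFG : ∀ x (hx : x ∈ S) (z : ℂ), z ∈ ball (x : ℂ) (ρ / 2) → F z = G x z := by
    intro x hx z hz
    have h : ∃ x ∈ S, z ∈ ball (x : ℂ) (ρ / 2) := ⟨x, hx, hz⟩
    have hF' : F z = G h.choose z := by simp only [hF, dif_pos h]
    rw [hF']
    exact hcons _ h.choose_spec.1 _ hx z h.choose_spec.2 hz
  refine ⟨F, fun z hz => ?_, fun t ht => ?_⟩
  · -- analyticity: near `z ∈ B(x, ρ/2)`, `F = G x`, the local extension at `x`
    rw [mem_iUnion₂] at hz
    obtain ⟨x, hx, hzx⟩ := hz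
    have hev : F =ᶠ[𝓝 z] G x := by
      filter_upwards [isOpen_ball.mem_nhds hzx] with z' hz'
      exact hFG x hx z' hz'
    refine AnalyticAt.congr ?_ hev.symm
    rw [hGS x hx]
    refine (hasFPowerSeriesOnBall_complexify (hp x hx)).analyticAt_of_mem ?_
    rw [Metric.eball_coe]
    exact ball_subset_ball (by linarith [(show (0:ℝ) ≤ ρ from ρ.2)]) hzx
  · -- real points
    rw [mem_iUnion₂] at ht
    obtain ⟨x, hx, htx⟩ := ht
    rw [hFG x hx _ htx, hGS x hx]
    refine complexify_sum_sub_eq (hp x hx) ?_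
    rw [ENNReal.coe_lt_coe, ← NNReal.coe_lt_coe, coe_nnnorm]
    rw [mem_ball, Complex.dist_eq, ← Complex.ofReal_sub, Complex.norm_real] at htx
    linarith [(show (0:ℝ) ≤ ρ from ρ.2)]

/-! ### Uniform radius on compact sets; the periodic case -/

omit [CompleteSpace E] in
/-- In `ℝ`, containment of balls forces the radii inequality `δ ≤ s - dist y x`. [folklore] -/
theorem dist_add_le_of_ball_subset_ball {x y δ s : ℝ} (hδ : 0 < δ) (h : ball y δ ⊆ ball x s) :
    dist y x + δ ≤ s := by
  rw [Real.ball_eq_Ioo, Real.ball_eq_Ioo, Ioo_subset_Ioo_iff (by linarith)] at h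
  rw [Real.dist_eq]
  have h' : |y - x| ≤ s - δ := abs_le.2 ⟨by linarith [h.1], by linarith [h.2]⟩
  linarith

/-- **Uniform radius of analyticity on a compact interval.**  If `f : ℝ → E` is real-analytic at
every point of `[a, b]`, there is `ρ > 0` such that `f` has a power series of radius `ρ` at every
point of `[a, b]` (Lebesgue number of the cover by half-balls of convergence, and re-expansion
`HasFPowerSeriesOnBall.changeOrigin`). [cite: KrantzParks2002, §1.2] -/
theorem exists_uniform_radius_of_isCompact {f : ℝ → E} {K : Set ℝ} (hK : IsCompact K)
    (hf : ∀ x ∈ K, AnalyticAt ℝ f x) :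
    ∃ ρ : ℝ≥0, 0 < ρ ∧ ∀ y ∈ K, ∃ q : FormalMultilinearSeries ℝ ℝ E, HasFPowerSeriesOnBall f q y ρ := by
  classical
  -- radii of convergence (real, positive) at the points of `K`
  have hr : ∀ x ∈ K, ∃ (p : FormalMultilinearSeries ℝ ℝ E) (r : ℝ≥0), 0 < r ∧
      HasFPowerSeriesOnBall f p x r := by
    intro x hx
    obtain ⟨p, r, hp⟩ := hf x hx
    obtain ⟨r', hr'0, hr'r⟩ := ENNReal.lt_iff_exists_nnreal_btwn.1 hp.r_pos
    exact ⟨p, r', by exact_mod_cast hr'0, hp.mono (by exact_mod_cast hr'0) hr'r.le⟩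
  choose p r hr0 hpr using hr
  -- the open cover of `K` by the half-balls `B(x, r_x / 2)`
  set c : K → Set ℝ := fun x => ball (x : ℝ) (r x x.2 / 2) with hc
  have hc₁ : ∀ i, IsOpen (c i) := fun i => isOpen_ball
  have hc₂ : K ⊆ ⋃ i, c i := fun x hx =>
    mem_iUnion.2 ⟨⟨x, hx⟩, mem_ball_self (half_pos (NNReal.coe_pos.2 (hr0 x hx)))⟩
  obtain ⟨δ, hδ, hδc⟩ := lebesgue_number_lemma_of_metric hK hc₁ hc₂
  set δ' : ℝ≥0 := ⟨δ, hδ.le⟩ with hδ'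
  have hδ'coe : (δ' : ℝ) = δ := rfl
  have hδ'pos : (0 : ℝ≥0) < δ' := by rw [← NNReal.coe_pos, hδ'coe]; exact hδ
  refine ⟨δ', hδ'pos, fun y hy => ?_⟩
  obtain ⟨⟨x, hx⟩, hsub⟩ := hδc y hy
  -- `dist y x + δ ≤ r_x / 2`, so re-expanding at `y` gives radius `≥ r_x - dist y x > δ`
  have hle : dist y x + δ ≤ r x hx / 2 := dist_add_le_of_ball_subset_ball hδ hsub
  have hr0' : (0 : ℝ) < r x hx := NNReal.coe_pos.2 (hr0 x hx)
  have hyx' : ‖y - x‖₊ < r x hx := by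
    rw [← NNReal.coe_lt_coe, coe_nnnorm, ← dist_eq_norm]
    linarith
  have hyx : (‖y - x‖₊ : ℝ≥0∞) < r x hx := by exact_mod_cast hyx'
  have hch := (hpr x hx).changeOrigin hyx
  rw [add_sub_cancel] at hch
  refine ⟨(p x hx).changeOrigin (y - x), hch.mono (by exact_mod_cast hδ'pos) ?_⟩
  -- `δ ≤ r_x - ‖y - x‖`
  have h1' : δ' + ‖y - x‖₊ ≤ r x hx := by
    rw [← NNReal.coe_le_coe, NNReal.coe_add, coe_nnnorm, ← dist_eq_norm, hδ'coe]
    linarith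
  have h1 : (δ' : ℝ≥0∞) + ‖y - x‖₊ ≤ r x hx := by exact_mod_cast h1'
  exact ENNReal.le_sub_of_add_le_right ENNReal.coe_ne_top h1

omit [CompleteSpace E] in
/-- A `T`-periodic function with a power series of radius `r` at `x₀` has the same power series
at `x₀ + n • T`. [folklore] -/
theorem periodic_hasFPowerSeriesOnBall_add_zsmul {f : ℝ → E} {T : ℝ}
    (hper : Periodic f T) {p : FormalMultilinearSeries ℝ ℝ E} {x₀ : ℝ} {r : ℝ≥0∞}
    (h : HasFPowerSeriesOnBall f p x₀ r) (n : ℤ) : HasFPowerSeriesOnBall f p (x₀ + n • T) r := by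
  refine ⟨h.r_le, h.r_pos, fun {y} hy => ?_⟩
  have key : f (x₀ + n • T + y) = f (x₀ + y) := by
    rw [add_assoc, add_comm (n • T) y, ← add_assoc]
    exact hper.zsmul n (x₀ + y)
  rw [key]
  exact h.hasSum hy

/-- **Uniform radius for a periodic real-analytic function**: every point of `ℝ` is a centre of an
expansion of one radius `ρ > 0`. [folklore] -/
theorem periodic_exists_uniform_radius {f : ℝ → E} {T : ℝ} (hT : 0 < T)
    (hper : Periodic f T) (hf : ∀ x, AnalyticAt ℝ f x) :
    ∃ ρ : ℝ≥0, 0 < ρ ∧ ∀ y : ℝ, ∃ q : FormalMultilinearSeries ℝ ℝ E, HasFPowerSeriesOnBall f q y ρ := by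
  obtain ⟨ρ, hρ, H⟩ := exists_uniform_radius_of_isCompact (isCompact_Icc (a := 0) (b := T))
    fun x _ => hf x
  refine ⟨ρ, hρ, fun y => ?_⟩
  -- `y = y₀ + n • T` with `y₀ ∈ [0, T)`
  have hy : toIcoMod hT 0 y + toIcoDiv hT 0 y • T = y := toIcoMod_add_toIcoDiv_zsmul hT 0 y
  have hy₀ : toIcoMod hT 0 y ∈ Icc (0 : ℝ) T := by
    have := toIcoMod_mem_Ico' hT y
    exact ⟨this.1, this.2.le⟩
  obtain ⟨q, hq⟩ := H _ hy₀
  refine ⟨q, ?_⟩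
  have := periodic_hasFPowerSeriesOnBall_add_zsmul hper hq (toIcoDiv hT 0 y)
  rwa [hy] at this

/-- **Holomorphic extension of a periodic real-analytic function to a strip.**  A `T`-periodic
real-analytic `f : ℝ → E` extends to a function `F : ℂ → E` holomorphic on a strip
`{|Im z| < δ}`, `δ > 0`, with `F = f` on the real axis and `F (z + T) = F z` on the strip.
[cite: KrantzParks2002, §1.2] -/
theorem periodic_exists_holomorphic_extension_strip {f : ℝ → E} {T : ℝ}
    (hT : 0 < T) (hper : Periodic f T) (hf : ∀ x, AnalyticAt ℝ f x) :
    ∃ δ : ℝ, 0 < δ ∧ ∃ F : ℂ → E, AnalyticOnNhd ℂ F {z : ℂ | |z.im| < δ} ∧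
      (∀ t : ℝ, F t = f t) ∧ ∀ z : ℂ, |z.im| < δ → F (z + T) = F z := by
  obtain ⟨ρ, hρ, H⟩ := periodic_exists_uniform_radius hT hper hf
  obtain ⟨F, hFa, hFf⟩ := exists_holomorphic_extension (S := univ) fun x _ => H x
  -- the strip `{|Im z| < ρ/2}` is the union of the half-balls centred on the real axis
  have hstrip : {z : ℂ | |z.im| < (ρ : ℝ) / 2} = ⋃ x ∈ (univ : Set ℝ), ball (x : ℂ) (ρ / 2) := by
    ext z
    simp only [mem_setOf_eq, mem_iUnion, mem_univ, exists_true_left, mem_ball]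
    constructor
    · intro hz
      refine ⟨z.re, ?_⟩
      rw [Complex.dist_eq]
      have : z - (z.re : ℂ) = (z.im : ℂ) * Complex.I := by
        apply Complex.ext <;> simp
      rw [this, norm_mul, Complex.norm_I, mul_one, Complex.norm_real, Real.norm_eq_abs]
      exact hz
    · rintro ⟨x, hx⟩
      rw [Complex.dist_eq] at hx
      have him : (z - (x : ℂ)).im = z.im := by simp
      calc |z.im| = |(z - (x : ℂ)).im| := by rw [him]
        _ ≤ ‖z - (x : ℂ)‖ := Complex.abs_im_le_norm _
        _ < ρ / 2 := hx
  have hρr : (0 : ℝ) < ρ := by exact_mod_cast hρ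
  have hρ2 : (0 : ℝ) < ρ / 2 := by linarith
  refine ⟨ρ / 2, hρ2, F, by rw [hstrip]; exact hFa, fun t => hFf t (by
    rw [← hstrip]; simp [hρ2]), fun z hz => ?_⟩
  -- periodicity on the strip by the identity theorem
  have hA : AnalyticOnNhd ℂ F {z : ℂ | |z.im| < (ρ : ℝ) / 2} := by rw [hstrip]; exact hFa
  have hA' : AnalyticOnNhd ℂ (fun z => F (z + T)) {z : ℂ | |z.im| < (ρ : ℝ) / 2} := by
    intro w hw
    have hw' : w + T ∈ {z : ℂ | |z.im| < (ρ : ℝ) / 2} := by simpa using hw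
    have hin : AnalyticAt ℂ (fun z : ℂ => z + T) w := analyticAt_id.add analyticAt_const
    exact AnalyticAt.comp (g := F) (f := fun z : ℂ => z + T) (x := w) (hA _ hw') hin
  have hconv : Convex ℝ {z : ℂ | |z.im| < (ρ : ℝ) / 2} := by
    have : {z : ℂ | |z.im| < (ρ : ℝ) / 2} = Complex.imCLM ⁻¹' (Ioo (-(ρ / 2 : ℝ)) (ρ / 2)) := by
      ext z; simp [abs_lt]
    rw [this]
    exact (convex_Ioo _ _).linear_preimage Complex.imCLM.toLinearMap
  have h0 : (0 : ℂ) ∈ {z : ℂ | |z.im| < (ρ : ℝ) / 2} := by simp [hρ2]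
  have hfreq : ∃ᶠ w in 𝓝[≠] (0 : ℂ), F (w + T) = F w := by
    -- along the real axis both sides equal `f`
    have hreal : ∀ s : ℝ, F ((s : ℂ) + T) = F s := by
      intro s
      have h1 : F ((s : ℂ) + T) = f (s + T) := by
        have := hFf (s + T) (by rw [← hstrip]; simp [hρ2])
        push_cast at this
        exact this
      rw [h1, hper s, hFf s (by rw [← hstrip]; simp [hρ2])]
    have htend : Tendsto (fun k : ℕ => ((1 / ((k : ℝ) + 1) : ℝ) : ℂ)) atTop (𝓝[≠] (0 : ℂ)) := by
      refine tendsto_nhdsWithin_iff.2 ⟨?_, Eventually.of_forall fun k => ?_⟩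
      · have h1 : Tendsto (fun k : ℕ => (1 / ((k : ℝ) + 1) : ℝ)) atTop (𝓝 0) :=
          tendsto_one_div_add_atTop_nhds_zero_nat
        have h2 := (Complex.continuous_ofReal.tendsto 0).comp h1
        rw [Complex.ofReal_zero] at h2
        exact h2
      · rw [mem_compl_iff, mem_singleton_iff, Complex.ofReal_eq_zero]
        exact one_div_ne_zero (Nat.cast_add_one_ne_zero k)
    exact htend.frequently (Frequently.of_forall fun k => hreal _)
  exact hA'.eqOn_of_preconnected_of_frequently_eq hA hconv.isPreconnected h0 hfreq hz

omit [CompleteSpace E] in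
/-- **The complex derivative of the extension at real points is the real derivative**: if `F` is
complex-differentiable at `t ∈ ℝ` and agrees with `f` on the real axis near `t`, then
`deriv F t = deriv f t`. [folklore] -/
theorem deriv_extension_ofReal {f : ℝ → E} {F : ℂ → E} {t : ℝ}
    (hF : DifferentiableAt ℂ F (t : ℂ)) (hFf : ∀ᶠ s : ℝ in 𝓝 t, F (s : ℂ) = f s) :
    deriv F (t : ℂ) = deriv f t := by
  have h1 : HasDerivAt (fun s : ℝ => F (s : ℂ)) (deriv F (t : ℂ)) t := by
    have h := (hF.hasFDerivAt.restrictScalars ℝ).comp_hasDerivAt t Complex.ofRealCLM.hasDerivAt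
    have heq : ((fderiv ℂ F (t : ℂ)).restrictScalars ℝ) (Complex.ofRealCLM 1) = deriv F (t : ℂ) := by
      simp
    rw [heq] at h
    exact h
  have h2 : HasDerivAt f (deriv F (t : ℂ)) t := h1.congr_of_eventuallyEq (by
    filter_upwards [hFf] with s hs
    exact hs.symm)
  exact h2.deriv.symm

/-! ### Globally periodic normalisation -/

omit [NormedAddCommGroup E] [NormedSpace ℂ E] [CompleteSpace E] in
/-- Periodicity on the strip iterates: `F (z + n • T) = F z` for all integers `n`, for `z` in the
(translation-invariant) strip. [folklore] -/
theorem strip_periodic_zsmul {F : ℂ → E} {T δ : ℝ}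
    (hF : ∀ z : ℂ, |z.im| < δ → F (z + T) = F z) {z : ℂ} (hz : |z.im| < δ) (n : ℤ) :
    F (z + n • (T : ℂ)) = F z := by
  -- one step up and one step down, then induction on `n`
  have up : ∀ w : ℂ, |w.im| < δ → F (w + T) = F w := hF
  have down : ∀ w : ℂ, |w.im| < δ → F (w - T) = F w := fun w hw => by
    have h := hF (w - T) (by simpa using hw)
    rw [sub_add_cancel] at h
    exact h.symm
  induction n using Int.induction_on with
  | zero => simp
  | succ k ih =>
    have hk : |(z + (k : ℤ) • (T : ℂ)).im| < δ := by simpa using hz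
    have := up _ hk
    rw [add_assoc] at this
    rw [show z + ((k : ℤ) + 1) • (T : ℂ) = z + ((k : ℤ) • (T : ℂ) + T) by rw [add_zsmul, one_zsmul],
      this, ih]
  | pred k ih =>
    have hk : |(z + (-(k : ℤ)) • (T : ℂ)).im| < δ := by simpa using hz
    have := down _ hk
    rw [add_sub_assoc] at this
    rw [show z + (-(k : ℤ) - 1) • (T : ℂ) = z + ((-(k : ℤ)) • (T : ℂ) - T) by module, this, ih]

/-- **The periodisation** of `F`: `periodize T hT F z = F (z - n • T)` with `n` the integer placing
`Re z - n T` in `[0, T)`.  It is globally `T`-periodic and agrees with `F` on the strip when `F` is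
periodic there. [folklore] -/
def periodize (T : ℝ) (hT : 0 < T) (F : ℂ → E) (z : ℂ) : E :=
  F (z - (toIcoDiv hT 0 z.re) • (T : ℂ))

omit [NormedAddCommGroup E] [NormedSpace ℂ E] [CompleteSpace E] in
/-- The periodisation is globally `T`-periodic. [folklore] -/
theorem periodic_periodize {T : ℝ} (hT : 0 < T) (F : ℂ → E) : Periodic (periodize T hT F) T := by
  intro z
  simp only [periodize, Complex.add_re, Complex.ofReal_re]
  rw [toIcoDiv_add_right, add_zsmul, one_zsmul]
  congr 1
  abel

omit [NormedAddCommGroup E] [NormedSpace ℂ E] [CompleteSpace E] in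
/-- On the strip, the periodisation of a strip-periodic `F` is `F`. [folklore] -/
theorem periodize_eq_of_strip {F : ℂ → E} {T δ : ℝ} (hT : 0 < T)
    (hF : ∀ z : ℂ, |z.im| < δ → F (z + T) = F z) {z : ℂ} (hz : |z.im| < δ) :
    periodize T hT F z = F z := by
  simp only [periodize]
  have h := strip_periodic_zsmul hF hz (-(toIcoDiv hT 0 z.re))
  rw [neg_zsmul, ← sub_eq_add_neg] at h
  exact h

/-- **Holomorphic extension of a periodic real-analytic function, globally periodic form.**  As
`periodic_exists_holomorphic_extension_strip`, with `F` in addition `T`-periodic on all of `ℂ`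
(so that e.g. Mathlib's `Function.Periodic.cuspFunction` applies componentwise).
[cite: KrantzParks2002, §1.2] -/
theorem periodic_exists_holomorphic_extension_strip' {f : ℝ → E} {T : ℝ}
    (hT : 0 < T) (hper : Periodic f T) (hf : ∀ x, AnalyticAt ℝ f x) :
    ∃ δ : ℝ, 0 < δ ∧ ∃ F : ℂ → E, AnalyticOnNhd ℂ F {z : ℂ | |z.im| < δ} ∧
      (∀ t : ℝ, F t = f t) ∧ Periodic F T := by
  obtain ⟨δ, hδ, F, hFa, hFf, hFp⟩ := periodic_exists_holomorphic_extension_strip hT hper hf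
  refine ⟨δ, hδ, periodize T hT F, fun z hz => ?_, fun t => ?_, periodic_periodize hT F⟩
  · -- near `z` the periodisation agrees with `F` shifted by a CONSTANT integer multiple of `T`
    -- only eventually if `Re z ∉ T ℤ`; instead use that it agrees with `F` itself on the strip
    have hev : periodize T hT F =ᶠ[𝓝 z] F := by
      have hopen : IsOpen {w : ℂ | |w.im| < δ} :=
        isOpen_lt (continuous_abs.comp Complex.continuous_im) continuous_const
      filter_upwards [hopen.mem_nhds hz] with w hw
      exact periodize_eq_of_strip hT hFp hw
    exact (hFa z hz).congr hev.symm
  · rw [periodize_eq_of_strip hT hFp (by simpa using hδ)]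
    exact hFf t

end Literature.Analysis.Complex

end
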